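import Mathlib
import HarnessLib
import Summits.ResolutionOfSingularities.ResolutionOfSingularities.Theorems.WildQuotientsWildQuotientResolutionS1aQhChartModel
import Summits.ResolutionOfSingularities.ResolutionOfSingularities.Theorems.WildQuotientsWildQuotientResolutionS1aTparabCover
import Summits.ResolutionOfSingularities.ResolutionOfSingularities.Theorems.WildQuotientsWildQuotientResolutionS1aSymMemberGraph
import Summits.ResolutionOfSingularities.ResolutionOfSingularities.Theorems.WildQuotientsWildQuotientResolutionS1aGraphShear
import Summits.ResolutionOfSingularities.ResolutionOfSingularities.Theorems.WildQuotientsWildQuotientResolutionS1aSymChartMemberLin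

/-!
# S1a — R4a `tparab`: THE GRAPH MEMBER `(x′₀ : 2, φ = x′₂ − x′₁² : 1; shift 1, β = s²)` ON A PRODUCER CHART OF THE QUASI-HOMOGENEOUS ROOT (3,1,2)

[OURS · L1 W4.5c · lead-1 g16; R4a brick 6 (plan-1 RULING R-F15n (2): «MEMBER on [X₁]: (X₀:2, φ := U − X₁² : 1; sh 1) with chains X₀ ← φ (mm 1, hunit −2X₁ — a unit on
[X₁] for p ≠ 2 — remainder −β²X₀² ∈ β𝒥₃) and φ ← x₃ (hunit 1); K1′ = the GRAPH LEMMA»); per-chart wrapper of ✓`exists_isPrincipalCentre_of_symMemberGraph` (`…S1aSymMemberGraph`)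
with K1′ from ✓`FreeModel.isRegular_away_X_graph` (`…S1aGraphShear`) and rows / degrees from ✓`…S1aQhChartModel`; pattern ✓`exists_isPrincipalCentre_of_symChartLin`] — NOT
statements of the manuscript; counted 0; AI-level work, weaker than expert review. Crux stmt-ResolutionOfSingularities-17941 `CyclicQuotientFourfolds`, line `s1a-logminvertex`
v13 (`stub_reachLowerInFX`).

* `tparab_model_degree_graph` — `φ = x′₂ − x′₁²` is homogeneous of degree `2θ` in the transported node grading (quasi-homogeneity of the tail);
* `exists_veroneseNormalised_tparabChart` — a Veronese degree for the member centre `(x′₀, φ)` with any weights;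
* ★★★ `exists_isPrincipalCentre_of_tparabChart` — on a producer chart `W` (σ-fixed cover element `y`, pinned root model `Ψ`, `x′₁ ∣ Ψ(yT^{dbar})`, the point `x′₁ = x′₂ = 1` off
  `Ψ(yT^{dbar}) = 0`, `2 ≠ 0` in `k`), with separating sections `u_i` (`E u_i = v_i/c`, `Ψ v_i ∈ (x′₀, φ)`): a PRINCIPAL centre of degree `d·l`, `W` a principal-centre chart,
  `supp ⊆ W`, `supp` disjoint from the `U_i`, trace formula — rows `τ′x′₁ = x′₁ + s²x′₀`, `τ′x′₂ = x′₂`, `τ′x₃ = x₃ + s²φ`, `τ′φ = φ + s²x′₀·(−2x′₁) + (s²x′₀)²·(−1)`.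
-/

set_option linter.dupNamespace false

noncomputable section

open CategoryTheory Limits AlgebraicGeometry TopologicalSpace Topology Opposite MvPolynomial
open Literature.AlgebraicGeometry.Resolution Literature.AlgebraicGeometry.RelativeSpec
open scoped LaurentPolynomial
open Summit.ResolutionOfSingularities.ResolutionOfSingularities.Theorems.WildQuotientResolution.S1
open Summit.ResolutionOfSingularities.ResolutionOfSingularities.Theorems.WildQuotientResolution.S1.NodeAtlas
open Summit.ResolutionOfSingularities.ResolutionOfSingularities.Theorems.WildQuotientResolution.S1.CoarseChart
open Summit.ResolutionOfSingularities.ResolutionOfSingularities.Theorems.WildQuotientResolution.S1.ProducerStep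
open Summit.ResolutionOfSingularities.ResolutionOfSingularities.Theorems.WildQuotientResolution.S1.NpFrame
open Summit.ResolutionOfSingularities.ResolutionOfSingularities.Theorems.WildQuotientResolution.S1.GoodCharts
open Summit.ResolutionOfSingularities.ResolutionOfSingularities.Theorems.WildQuotientResolution.S1.BlowupCharts
open Summit.ResolutionOfSingularities.ResolutionOfSingularities.Theorems.WildQuotientResolution.S1.KillCert
open Summit.ResolutionOfSingularities.ResolutionOfSingularities.Theorems.WildQuotientResolution.S1.ReesBigrading
open Summit.ResolutionOfSingularities.ResolutionOfSingularities.Theorems.WildQuotientResolution.S1.NodeTransport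
open Summit.ResolutionOfSingularities.ResolutionOfSingularities.Theorems.WildQuotientResolution.S1.CobordantTransport
open Summit.ResolutionOfSingularities.ResolutionOfSingularities.Theorems.WildQuotientResolution.S1.FreeModel

namespace Summit.ResolutionOfSingularities.ResolutionOfSingularities.Theorems.WildQuotientResolution.S1.GameFrame.GModel

variable {p : ℕ} {X' X₁ : Scheme.{0}} {q : X' ⟶ X₁} {G : Type} [Group G] {ρ : G →* Aut X'} {g₀ : G}

/-- The graph generator `φ = x′₂ − x′₁²` has degree `2θ` in the transported grading of a producer chart of the root `(3,1,2)`. -/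
theorem tparab_model_degree_graph {k : Type} [Field k] {A : Type} [CommRing A] (e : A ≃+* MvPolynomial (Fin 4) k)
    (Ψ : ↥(cobordantAlgebra (e.symm ∘ ![X 0, X 1, X 2] : Fin 3 → A) ![3, 1, 2]) ≃+* MvPolynomial (Option (Fin 4)) k)
    (hΨu : ∀ i : Fin 3, Ψ (cobordantAlgebra.u' (e.symm ∘ ![X 0, X 1, X 2] : Fin 3 → A) ![3, 1, 2] i) = X (some (Fin.castSucc i)))
    {m : ℕ} (mo : Fin m → ℕ) (𝒜 : (Π j : Fin m, ZMod (mo j)) → AddSubgroup A) [GradedRing 𝒜]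
    (hf : ∀ i, (e.symm ∘ ![X 0, X 1, X 2] : Fin 3 → A) i ∈ 𝒜 ((fun _ => (0 : Π j : Fin m, ZMod (mo j))) i))
    {dbar : ℕ} (y : ↥(𝒜 0)) (hy : y ∈ (traceFiltration 𝒜 (e.symm ∘ ![X 0, X 1, X 2] : Fin 3 → A) ![3, 1, 2]).ideal dbar) :
    letI := chartNodeGradedRing mo 𝒜 (e.symm ∘ ![X 0, X 1, X 2] : Fin 3 → A) ![3, 1, 2] hf dbar y hy
    algebraMap (MvPolynomial (Option (Fin 4)) k) (Localization.Away (Ψ (coverElement 𝒜 _ _ dbar y hy))) (X (some 2) - X (some 1) ^ 2 : MvPolynomial (Option (Fin 4)) k) ∈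
      mapGrading (chartNodeGrading mo 𝒜 (e.symm ∘ ![X 0, X 1, X 2] : Fin 3 → A) ![3, 1, 2] hf dbar y hy) (chartRingEquivAway 𝒜 _ _ dbar y hy Ψ)
        (2 • consIndexEquiv mo ((1 : ℤ), (0 : Π j : Fin m, ZMod (mo j)))) := by
  letI := chartNodeGradedRing mo 𝒜 (e.symm ∘ ![X 0, X 1, X 2] : Fin 3 → A) ![3, 1, 2] hf dbar y hy
  letI := mapGradedRing (chartNodeGrading mo 𝒜 (e.symm ∘ ![X 0, X 1, X 2] : Fin 3 → A) ![3, 1, 2] hf dbar y hy) (chartRingEquivAway 𝒜 _ _ dbar y hy Ψ)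
  rw [map_sub, map_pow]
  have h2 := Qh.qh_model_degree_u' ![3, 1, 2] e Ψ hΨu mo 𝒜 hf y hy 2
  have h1 := Qh.qh_model_degree_u' ![3, 1, 2] e Ψ hΨu mo 𝒜 hf y hy 1
  have h11 := SetLike.pow_mem_graded 2 h1
  change algebraMap (MvPolynomial (Option (Fin 4)) k) (Localization.Away (Ψ (coverElement 𝒜 _ _ dbar y hy))) (X (some 2)) ∈
    mapGrading _ _ (2 • consIndexEquiv mo ((1 : ℤ), (0 : Π j : Fin m, ZMod (mo j)))) at h2
  change algebraMap (MvPolynomial (Option (Fin 4)) k) (Localization.Away (Ψ (coverElement 𝒜 _ _ dbar y hy))) (X (some 1)) ^ 2 ∈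
    mapGrading _ _ (2 • (1 • consIndexEquiv mo ((1 : ℤ), (0 : Π j : Fin m, ZMod (mo j))))) at h11
  rw [one_smul] at h11
  exact sub_mem h2 h11

/-- **A Veronese degree for the graph member centre `(x′₀ : w₀, x′₂ − x′₁² : w₁)`** on a producer chart of the quasi-homogeneous root `(3,1,2)`. -/
theorem exists_veroneseNormalised_tparabChart {k : Type} [Field k] {A : Type} [CommRing A] (e : A ≃+* MvPolynomial (Fin 4) k) (τ : A ≃+* A)
    (hp : 0 < p) (hσp : ∀ x : A, (⇑τ)^[p] x = x)
    (hσJ : ∀ n : ℕ, ((weightedFiltration (e.symm ∘ ![X 0, X 1, X 2] : Fin 3 → A) ![3, 1, 2]).ideal n).map (τ : A →+* A) ≤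
      (weightedFiltration (e.symm ∘ ![X 0, X 1, X 2] : Fin 3 → A) ![3, 1, 2]).ideal n)
    {m : ℕ} (mo : Fin m → ℕ) (𝒜 : (Π j : Fin m, ZMod (mo j)) → AddSubgroup A) [GradedRing 𝒜]
    (hf : ∀ i, (e.symm ∘ ![X 0, X 1, X 2] : Fin 3 → A) i ∈ 𝒜 ((fun _ => (0 : Π j : Fin m, ZMod (mo j))) i))
    {dbar : ℕ} (y : ↥(𝒜 0)) (hy : y ∈ (traceFiltration 𝒜 (e.symm ∘ ![X 0, X 1, X 2] : Fin 3 → A) ![3, 1, 2]).ideal dbar) (hσy : τ (y : A) = y)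
    (Ψ : ↥(cobordantAlgebra (e.symm ∘ ![X 0, X 1, X 2] : Fin 3 → A) ![3, 1, 2]) ≃+* MvPolynomial (Option (Fin 4)) k)
    (hΨu : ∀ i : Fin 3, Ψ (cobordantAlgebra.u' (e.symm ∘ ![X 0, X 1, X 2] : Fin 3 → A) ![3, 1, 2] i) = X (some (Fin.castSucc i)))
    (htame : letI := chartNodeGradedRing mo 𝒜 (e.symm ∘ ![X 0, X 1, X 2] : Fin 3 → A) ![3, 1, 2] hf dbar y hy
      IsTameNode p (ChartRing 𝒜 (e.symm ∘ ![X 0, X 1, X 2] : Fin 3 → A) ![3, 1, 2] dbar y hy)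
        (chartNodeGrading mo 𝒜 (e.symm ∘ ![X 0, X 1, X 2] : Fin 3 → A) ![3, 1, 2] hf dbar y hy)
        (sigmaChart 𝒜 (e.symm ∘ ![X 0, X 1, X 2] : Fin 3 → A) ![3, 1, 2] dbar y hy τ hσJ hp hσp hσy))
    (w : Fin 2 → ℕ) :
    letI := chartNodeGradedRing mo 𝒜 (e.symm ∘ ![X 0, X 1, X 2] : Fin 3 → A) ![3, 1, 2] hf dbar y hy
    letI := mapGradedRing (chartNodeGrading mo 𝒜 (e.symm ∘ ![X 0, X 1, X 2] : Fin 3 → A) ![3, 1, 2] hf dbar y hy) (chartRingEquivAway 𝒜 _ _ dbar y hy Ψ)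
    ∃ d : ℕ, VeroneseNormalised (mapGrading (chartNodeGrading mo 𝒜 (e.symm ∘ ![X 0, X 1, X 2] : Fin 3 → A) ![3, 1, 2] hf dbar y hy) (chartRingEquivAway 𝒜 _ _ dbar y hy Ψ))
        (![algebraMap (MvPolynomial (Option (Fin 4)) k) (Localization.Away (Ψ (coverElement 𝒜 _ _ dbar y hy))) (X (some 0)),
          algebraMap (MvPolynomial (Option (Fin 4)) k) (Localization.Away (Ψ (coverElement 𝒜 _ _ dbar y hy))) (X (some 2) - X (some 1) ^ 2 : MvPolynomial (Option (Fin 4)) k)] :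
            Fin 2 → (Localization.Away (Ψ (coverElement 𝒜 _ _ dbar y hy)))) w d := by
  letI instN := chartNodeGradedRing mo 𝒜 (e.symm ∘ ![X 0, X 1, X 2] : Fin 3 → A) ![3, 1, 2] hf dbar y hy
  letI instP := mapGradedRing (chartNodeGrading mo 𝒜 (e.symm ∘ ![X 0, X 1, X 2] : Fin 3 → A) ![3, 1, 2] hf dbar y hy) (chartRingEquivAway 𝒜 _ _ dbar y hy Ψ)
  have htameT := isTameNode_map (chartNodeGrading mo 𝒜 (e.symm ∘ ![X 0, X 1, X 2] : Fin 3 → A) ![3, 1, 2] hf dbar y hy)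
    (chartRingEquivAway 𝒜 _ _ dbar y hy Ψ) p _ htame
  exact Veronese.veroneseNormalisation _ _ _ htameT.2.2.2.1 2 _
    ![((![3, 1, 2] : Fin 3 → ℕ) 0) • consIndexEquiv mo ((1 : ℤ), (0 : Π j : Fin m, ZMod (mo j))), 2 • consIndexEquiv mo ((1 : ℤ), (0 : Π j : Fin m, ZMod (mo j)))] w
    (fun i => by fin_cases i; exacts [Qh.qh_model_degree_u' ![3, 1, 2] e Ψ hΨu mo 𝒜 hf y hy 0, tparab_model_degree_graph e Ψ hΨu mo 𝒜 hf y hy])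

set_option maxHeartbeats 8000000 in
set_option synthInstance.maxHeartbeats 400000 in
/-- ★★★ **THE GRAPH MEMBER ON A PRODUCER CHART OF THE QUASI-HOMOGENEOUS ROOT (R4a `tparab`)**: component `V(x′₀, x′₂ − x′₁²)`. See the module docstring.
[OURS · L1 W4.5c · R4a graph member per chart; NOT a statement of the manuscript] -/
theorem exists_isPrincipalCentre_of_tparabChart [Finite G] (hG : ∀ g : G, g ∈ Subgroup.zpowers g₀)
    {k : Type} [Field k] {A : Type} [CommRing A]
    (σ : MvPolynomial (Fin 4) k ≃+* MvPolynomial (Fin 4) k) (hC : ∀ a : k, σ (C a) = C a)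
    (h0 : σ (X 0) = X 0) (h1 : σ (X 1) = X 1 + X 0) (h2 : σ (X 2) = X 2) (h3 : σ (X 3) = X 3 + (X 2 - X 1 ^ 2))
    (e : A ≃+* MvPolynomial (Fin 4) k) (τ : A ≃+* A) (hact : ∀ x : A, τ x = e.symm (σ (e x)))
    (hp : 0 < p) (hσp : ∀ x : A, (⇑τ)^[p] x = x)
    (hσJ : ∀ n : ℕ, ((weightedFiltration (e.symm ∘ ![X 0, X 1, X 2] : Fin 3 → A) ![3, 1, 2]).ideal n).map (τ : A →+* A) ≤
      (weightedFiltration (e.symm ∘ ![X 0, X 1, X 2] : Fin 3 → A) ![3, 1, 2]).ideal n)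
    (hk2 : (2 : k) ≠ 0)
    {m : ℕ} (mo : Fin m → ℕ) (𝒜 : (Π j : Fin m, ZMod (mo j)) → AddSubgroup A) [GradedRing 𝒜]
    (hf : ∀ i, (e.symm ∘ ![X 0, X 1, X 2] : Fin 3 → A) i ∈ 𝒜 ((fun _ => (0 : Π j : Fin m, ZMod (mo j))) i))
    {dbar : ℕ} (y : ↥(𝒜 0)) (hy : y ∈ (traceFiltration 𝒜 (e.symm ∘ ![X 0, X 1, X 2] : Fin 3 → A) ![3, 1, 2]).ideal dbar) (hσy : τ (y : A) = y)
    -- the pinned root model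
    (Ψ : ↥(cobordantAlgebra (e.symm ∘ ![X 0, X 1, X 2] : Fin 3 → A) ![3, 1, 2]) ≃+* MvPolynomial (Option (Fin 4)) k)
    (hΨa : ∀ a : MvPolynomial (Fin 4) k, Ψ (algebraMap A _ (e.symm a)) = cobordantAlgebra.subst k (![(![3, 1, 2] : Fin 3 → ℕ) 0, (![3, 1, 2] : Fin 3 → ℕ) 1, (![3, 1, 2] : Fin 3 → ℕ) 2, 0] : Fin 4 → ℕ) a)
    (hΨs : Ψ (cobordantAlgebra.s _ _) = X none)
    (hΨu : ∀ i : Fin 3, Ψ (cobordantAlgebra.u' (e.symm ∘ ![X 0, X 1, X 2] : Fin 3 → A) ![3, 1, 2] i) = X (some (Fin.castSucc i)))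
    -- the chart and its producer node
    (M : GModel p q G ρ g₀) [M.V.IsSeparated] (W : M.act.StableAffineOpens) (hW : IsAffineOpen W.1)
    (E : letI := chartNodeGradedRing mo 𝒜 (e.symm ∘ ![X 0, X 1, X 2] : Fin 3 → A) ![3, 1, 2] hf dbar y hy
      Γ(M.V, W.1) ≃+* ↥(chartNodeGrading mo 𝒜 (e.symm ∘ ![X 0, X 1, X 2] : Fin 3 → A) ![3, 1, 2] hf dbar y hy 0))
    (htame : letI := chartNodeGradedRing mo 𝒜 (e.symm ∘ ![X 0, X 1, X 2] : Fin 3 → A) ![3, 1, 2] hf dbar y hy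
      IsTameNode p (ChartRing 𝒜 (e.symm ∘ ![X 0, X 1, X 2] : Fin 3 → A) ![3, 1, 2] dbar y hy)
        (chartNodeGrading mo 𝒜 (e.symm ∘ ![X 0, X 1, X 2] : Fin 3 → A) ![3, 1, 2] hf dbar y hy)
        (sigmaChart 𝒜 (e.symm ∘ ![X 0, X 1, X 2] : Fin 3 → A) ![3, 1, 2] dbar y hy τ hσJ hp hσp hσy))
    (hE : letI := chartNodeGradedRing mo 𝒜 (e.symm ∘ ![X 0, X 1, X 2] : Fin 3 → A) ![3, 1, 2] hf dbar y hy
      ∀ t' : Γ(M.V, W.1), ((E ((M.act.aut g₀⁻¹).hom.appLE W.1 W.1 (W.2.1 g₀⁻¹).ge t') :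
          ↥(chartNodeGrading mo 𝒜 (e.symm ∘ ![X 0, X 1, X 2] : Fin 3 → A) ![3, 1, 2] hf dbar y hy 0)) :
            ChartRing 𝒜 (e.symm ∘ ![X 0, X 1, X 2] : Fin 3 → A) ![3, 1, 2] dbar y hy) =
        sigmaChart 𝒜 (e.symm ∘ ![X 0, X 1, X 2] : Fin 3 → A) ![3, 1, 2] dbar y hy τ hσJ hp hσp hσy
          ((E t' : ↥(chartNodeGrading mo 𝒜 (e.symm ∘ ![X 0, X 1, X 2] : Fin 3 → A) ![3, 1, 2] hf dbar y hy 0)) :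
            ChartRing 𝒜 (e.symm ∘ ![X 0, X 1, X 2] : Fin 3 → A) ![3, 1, 2] dbar y hy))
    -- `x′₁` is a unit on the chart; a point of the component off `Ψ(yT^{dbar}) = 0`; the Veronese degree
    (hdvd : (X (some 1) : MvPolynomial (Option (Fin 4)) k) ∣ Ψ (coverElement 𝒜 _ _ dbar y hy))
    (hu : MvPolynomial.eval (fun o : Option (Fin 4) => o.elim (0 : k) ![0, 1, 1, 0]) (Ψ (coverElement 𝒜 _ _ dbar y hy)) ≠ 0)
    (d : ℕ) (l : ℕ) (hl : 0 < l)
    (hver : letI := chartNodeGradedRing mo 𝒜 (e.symm ∘ ![X 0, X 1, X 2] : Fin 3 → A) ![3, 1, 2] hf dbar y hy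
      letI := mapGradedRing (chartNodeGrading mo 𝒜 (e.symm ∘ ![X 0, X 1, X 2] : Fin 3 → A) ![3, 1, 2] hf dbar y hy) (chartRingEquivAway 𝒜 _ _ dbar y hy Ψ)
      VeroneseNormalised (mapGrading (chartNodeGrading mo 𝒜 (e.symm ∘ ![X 0, X 1, X 2] : Fin 3 → A) ![3, 1, 2] hf dbar y hy) (chartRingEquivAway 𝒜 _ _ dbar y hy Ψ))
        (![algebraMap (MvPolynomial (Option (Fin 4)) k) (Localization.Away (Ψ (coverElement 𝒜 _ _ dbar y hy))) (X (some 0)),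
          algebraMap (MvPolynomial (Option (Fin 4)) k) (Localization.Away (Ψ (coverElement 𝒜 _ _ dbar y hy))) (X (some 2) - X (some 1) ^ 2 : MvPolynomial (Option (Fin 4)) k)] :
            Fin 2 → (Localization.Away (Ψ (coverElement 𝒜 _ _ dbar y hy)))) ![2, 1] d)
    -- separating sections
    {κ : Type} (U : κ → M.V.Opens) (hcov : ∀ x : M.V, x ∈ W.1 ∨ ∃ i, x ∈ U i) (u : κ → Γ(M.V, W.1))
    (v : κ → ↥(cobordantAlgebra (e.symm ∘ ![X 0, X 1, X 2] : Fin 3 → A) ![3, 1, 2]))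
    (huv : letI := chartNodeGradedRing mo 𝒜 (e.symm ∘ ![X 0, X 1, X 2] : Fin 3 → A) ![3, 1, 2] hf dbar y hy
      ∀ i, ((E (u i) : ↥(chartNodeGrading mo 𝒜 (e.symm ∘ ![X 0, X 1, X 2] : Fin 3 → A) ![3, 1, 2] hf dbar y hy 0)) :
          ChartRing 𝒜 (e.symm ∘ ![X 0, X 1, X 2] : Fin 3 → A) ![3, 1, 2] dbar y hy) =
        algebraMap _ (ChartRing 𝒜 (e.symm ∘ ![X 0, X 1, X 2] : Fin 3 → A) ![3, 1, 2] dbar y hy) (v i) * IsLocalization.Away.invSelf (coverElement 𝒜 _ _ dbar y hy))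
    (hΨv : ∀ i, Ψ (v i) ∈ Ideal.span ({X (some 0), X (some 2) - X (some 1) ^ 2} : Set (MvPolynomial (Option (Fin 4)) k)))
    (huU : ∀ i, ∀ x ∈ W.1, x ∈ U i → x ∈ M.V.basicOpen (u i)) :
    letI := chartNodeGradedRing mo 𝒜 (e.symm ∘ ![X 0, X 1, X 2] : Fin 3 → A) ![3, 1, 2] hf dbar y hy
    letI := mapGradedRing (chartNodeGrading mo 𝒜 (e.symm ∘ ![X 0, X 1, X 2] : Fin 3 → A) ![3, 1, 2] hf dbar y hy) (chartRingEquivAway 𝒜 _ _ dbar y hy Ψ)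
    ∃ J : ReesFiltration M.V, IsPrincipalCentre p M.act g₀ J (d * l) ∧ IsPrincipalCentreChart p M.act g₀ J (d * l) W ∧
      (((J.ideal (d * l)).support : Set M.V)) ⊆ (W.1 : Set M.V) ∧ (∀ i, Disjoint ((U i : Set M.V)) (((J.ideal (d * l)).support : Set M.V))) ∧
      ∀ n, (J.filtration ⟨W.1, hW⟩).ideal n =
        ((traceFiltration (mapGrading (chartNodeGrading mo 𝒜 (e.symm ∘ ![X 0, X 1, X 2] : Fin 3 → A) ![3, 1, 2] hf dbar y hy) (chartRingEquivAway 𝒜 _ _ dbar y hy Ψ))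
          (![algebraMap (MvPolynomial (Option (Fin 4)) k) (Localization.Away (Ψ (coverElement 𝒜 _ _ dbar y hy))) (X (some 0)),
            algebraMap (MvPolynomial (Option (Fin 4)) k) (Localization.Away (Ψ (coverElement 𝒜 _ _ dbar y hy))) (X (some 2) - X (some 1) ^ 2 : MvPolynomial (Option (Fin 4)) k)] :
              Fin 2 → (Localization.Away (Ψ (coverElement 𝒜 _ _ dbar y hy)))) ![2, 1]).ideal n).comap
          ((E.trans (zeroRingEquiv (chartNodeGrading mo 𝒜 (e.symm ∘ ![X 0, X 1, X 2] : Fin 3 → A) ![3, 1, 2] hf dbar y hy) (chartRingEquivAway 𝒜 _ _ dbar y hy Ψ)) :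
            Γ(M.V, W.1) ≃+* _) : Γ(M.V, W.1) →+* _) := by
  letI instN := chartNodeGradedRing mo 𝒜 (e.symm ∘ ![X 0, X 1, X 2] : Fin 3 → A) ![3, 1, 2] hf dbar y hy
  letI instP := mapGradedRing (chartNodeGrading mo 𝒜 (e.symm ∘ ![X 0, X 1, X 2] : Fin 3 → A) ![3, 1, 2] hf dbar y hy) (chartRingEquivAway 𝒜 _ _ dbar y hy Ψ)
  have hver' := CoarseChart.veroneseNormalised_mul _ _ _ hver hl
  have hw0 : (![3, 1, 2] : Fin 3 → ℕ) 0 = (![3, 1, 2] : Fin 3 → ℕ) 1 + 2 := rfl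
  have ht := KillCert.Tparab.tparab_tail_mem e
  -- rows of `τ′ = conj Φ σ_chart` in the free model
  obtain ⟨rn, r0, r2, rfix⟩ := Qh.qh_model_rows_fixed σ hC h0 h2 ![3, 1, 2] e τ hact hp hσp hσJ Ψ hΨa hΨs hΨu mo 𝒜 y hy hσy
  have r1 := Qh.qh_model_row_one σ h1 ![3, 1, 2] 2 e τ hact hw0 hp hσp hσJ Ψ hΨs hΨu mo 𝒜 y hy hσy
  have r3 := Qh.qh_model_row_three σ ![3, 1, 2] 2 (X 2 - X 1 ^ 2) h3 e τ hact ht hp hσp hσJ Ψ hΨa hΨs mo 𝒜 y hy hσy (X (some 2) - X (some 1) ^ 2)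
    (KillCert.Tparab.tparab_subst_tail (k := k))
  have dg0 := Qh.qh_model_degree_u' ![3, 1, 2] e Ψ hΨu mo 𝒜 hf y hy 0
  have hφd := tparab_model_degree_graph e Ψ hΨu mo 𝒜 hf y hy
  -- the component `φ = x′₂ − x′₁²`: row
  have hφrow : conj (chartRingEquivAway 𝒜 _ _ dbar y hy Ψ) (sigmaChart 𝒜 _ _ dbar y hy τ hσJ hp hσp hσy)
      (algebraMap (MvPolynomial (Option (Fin 4)) k) (Localization.Away (Ψ (coverElement 𝒜 _ _ dbar y hy))) (X (some 2) - X (some 1) ^ 2 : MvPolynomial (Option (Fin 4)) k)) =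
      algebraMap (MvPolynomial (Option (Fin 4)) k) (Localization.Away (Ψ (coverElement 𝒜 _ _ dbar y hy))) (X (some 2) - X (some 1) ^ 2 : MvPolynomial (Option (Fin 4)) k) +
        algebraMap (MvPolynomial (Option (Fin 4)) k) (Localization.Away (Ψ (coverElement 𝒜 _ _ dbar y hy))) (X none) ^ 2 *
          algebraMap (MvPolynomial (Option (Fin 4)) k) (Localization.Away (Ψ (coverElement 𝒜 _ _ dbar y hy))) (X (some 0)) *
          (-(2 * algebraMap (MvPolynomial (Option (Fin 4)) k) (Localization.Away (Ψ (coverElement 𝒜 _ _ dbar y hy))) (X (some 1)))) +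
        (algebraMap (MvPolynomial (Option (Fin 4)) k) (Localization.Away (Ψ (coverElement 𝒜 _ _ dbar y hy))) (X none) ^ 2 *
          algebraMap (MvPolynomial (Option (Fin 4)) k) (Localization.Away (Ψ (coverElement 𝒜 _ _ dbar y hy))) (X (some 0))) ^ 2 * (-1) := by
    simp only [map_sub, map_pow, r1, r2]
    ring
  -- K1′ by the graph shear
  obtain ⟨hK1, hK1'⟩ := FreeModel.isRegular_away_X_graph k (Ψ (coverElement 𝒜 _ _ dbar y hy)) (some 0) (some 2) (by decide) (X (some 1) ^ 2)
    (fun f hf' => by rw [map_pow, aeval_X, hf' (some 1) (by decide)])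
    (fun o : Option (Fin 4) => o.elim (0 : k) ![0, 1, 1, 0]) rfl
    (by rw [map_pow, MvPolynomial.eval_X, Option.elim_some, Option.elim_some]; exact (one_pow 2).symm) hu
  -- units: `x′₁` and `−2x′₁`
  have hX1unit : IsUnit (algebraMap (MvPolynomial (Option (Fin 4)) k) (Localization.Away (Ψ (coverElement 𝒜 _ _ dbar y hy))) (X (some 1))) :=
    IsLocalization.Away.isUnit_of_dvd _ hdvd
  have h2unit : IsUnit (2 : Localization.Away (Ψ (coverElement 𝒜 _ _ dbar y hy))) := by
    have h := (Ne.isUnit hk2).map (algebraMap k (Localization.Away (Ψ (coverElement 𝒜 _ _ dbar y hy))))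
    rwa [map_ofNat] at h
  have hhu : IsUnit (-(2 * algebraMap (MvPolynomial (Option (Fin 4)) k) (Localization.Away (Ψ (coverElement 𝒜 _ _ dbar y hy))) (X (some 1)))) :=
    (h2unit.mul hX1unit).neg
  -- the separating sections lie in the member filtration
  have huJ : ∀ i, chartRingEquivAway 𝒜 _ _ dbar y hy Ψ ((E (u i) : ↥(chartNodeGrading mo 𝒜 (e.symm ∘ ![X 0, X 1, X 2] : Fin 3 → A) ![3, 1, 2] hf dbar y hy 0)) :
        ChartRing 𝒜 (e.symm ∘ ![X 0, X 1, X 2] : Fin 3 → A) ![3, 1, 2] dbar y hy) ∈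
      (weightedFiltration (![algebraMap (MvPolynomial (Option (Fin 4)) k) (Localization.Away (Ψ (coverElement 𝒜 _ _ dbar y hy))) (X (some 0)),
          algebraMap (MvPolynomial (Option (Fin 4)) k) (Localization.Away (Ψ (coverElement 𝒜 _ _ dbar y hy))) (X (some 2) - X (some 1) ^ 2 : MvPolynomial (Option (Fin 4)) k)] :
            Fin 2 → (Localization.Away (Ψ (coverElement 𝒜 _ _ dbar y hy)))) ![2, 1]).ideal 1 := by
    intro i
    rw [huv i, chartRingEquivAway_algebraMap_mul_invSelf]
    refine Ideal.mul_mem_right _ _ ?_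
    have hle : (Ideal.span ({X (some 0), X (some 2) - X (some 1) ^ 2} : Set (MvPolynomial (Option (Fin 4)) k))).map
        (algebraMap (MvPolynomial (Option (Fin 4)) k) (Localization.Away (Ψ (coverElement 𝒜 _ _ dbar y hy)))) ≤
        (weightedFiltration (![algebraMap (MvPolynomial (Option (Fin 4)) k) (Localization.Away (Ψ (coverElement 𝒜 _ _ dbar y hy))) (X (some 0)),
          algebraMap (MvPolynomial (Option (Fin 4)) k) (Localization.Away (Ψ (coverElement 𝒜 _ _ dbar y hy))) (X (some 2) - X (some 1) ^ 2 : MvPolynomial (Option (Fin 4)) k)] :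
            Fin 2 → (Localization.Away (Ψ (coverElement 𝒜 _ _ dbar y hy)))) ![2, 1]).ideal 1 := by
      rw [Ideal.map_span, Ideal.span_le]
      rintro _ ⟨g, hg, rfl⟩
      simp only [Set.mem_insert_iff, Set.mem_singleton_iff] at hg
      rcases hg with rfl | rfl
      · exact (weightedFiltration _ _).antitone (by norm_num)
          (mem_weightedFiltration_ideal (![algebraMap (MvPolynomial (Option (Fin 4)) k) (Localization.Away (Ψ (coverElement 𝒜 _ _ dbar y hy))) (X (some 0)),
            algebraMap (MvPolynomial (Option (Fin 4)) k) (Localization.Away (Ψ (coverElement 𝒜 _ _ dbar y hy))) (X (some 2) - X (some 1) ^ 2 : MvPolynomial (Option (Fin 4)) k)] :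
              Fin 2 → (Localization.Away (Ψ (coverElement 𝒜 _ _ dbar y hy)))) ![2, 1] 0)
      · exact mem_weightedFiltration_ideal (![algebraMap (MvPolynomial (Option (Fin 4)) k) (Localization.Away (Ψ (coverElement 𝒜 _ _ dbar y hy))) (X (some 0)),
            algebraMap (MvPolynomial (Option (Fin 4)) k) (Localization.Away (Ψ (coverElement 𝒜 _ _ dbar y hy))) (X (some 2) - X (some 1) ^ 2 : MvPolynomial (Option (Fin 4)) k)] :
              Fin 2 → (Localization.Away (Ψ (coverElement 𝒜 _ _ dbar y hy)))) ![2, 1] 1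
    exact hle (Ideal.mem_map_of_mem _ (hΨv i))
  exact exists_isPrincipalCentre_of_symMemberGraph hG M W
    ({ affine := hW, m := m + 1, r := Fin.cons 0 mo, B := ChartRing 𝒜 (e.symm ∘ ![X 0, X 1, X 2] : Fin 3 → A) ![3, 1, 2] dbar y hy,
       𝒜 := chartNodeGrading mo 𝒜 (e.symm ∘ ![X 0, X 1, X 2] : Fin 3 → A) ![3, 1, 2] hf dbar y hy,
       σ := sigmaChart 𝒜 (e.symm ∘ ![X 0, X 1, X 2] : Fin 3 → A) ![3, 1, 2] dbar y hy τ hσJ hp hσp hσy,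
       e := E, tame := htame, intertwine := hE } : NodeData p M.act g₀ W)
    (chartRingEquivAway 𝒜 _ _ dbar y hy Ψ)
    (conj (chartRingEquivAway 𝒜 _ _ dbar y hy Ψ) (sigmaChart 𝒜 _ _ dbar y hy τ hσJ hp hσp hσy)) (fun _ => rfl)
    (algebraMap (MvPolynomial (Option (Fin 4)) k) (Localization.Away (Ψ (coverElement 𝒜 _ _ dbar y hy))) (X none))
    (algebraMap (MvPolynomial (Option (Fin 4)) k) (Localization.Away (Ψ (coverElement 𝒜 _ _ dbar y hy))) (X (some 0)))
    (algebraMap (MvPolynomial (Option (Fin 4)) k) (Localization.Away (Ψ (coverElement 𝒜 _ _ dbar y hy))) (X (some 1)))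
    (algebraMap (MvPolynomial (Option (Fin 4)) k) (Localization.Away (Ψ (coverElement 𝒜 _ _ dbar y hy))) (X (some 2)))
    (algebraMap (MvPolynomial (Option (Fin 4)) k) (Localization.Away (Ψ (coverElement 𝒜 _ _ dbar y hy))) (X (some 3)))
    (algebraMap (MvPolynomial (Option (Fin 4)) k) (Localization.Away (Ψ (coverElement 𝒜 _ _ dbar y hy))) (X (some 2) - X (some 1) ^ 2 : MvPolynomial (Option (Fin 4)) k))
    (algebraMap (MvPolynomial (Option (Fin 4)) k) (Localization.Away (Ψ (coverElement 𝒜 _ _ dbar y hy))) (X (some 2) - X (some 1) ^ 2 : MvPolynomial (Option (Fin 4)) k))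
    1 1 0 (-(2 * algebraMap (MvPolynomial (Option (Fin 4)) k) (Localization.Away (Ψ (coverElement 𝒜 _ _ dbar y hy))) (X (some 1)))) (-1) 2 _
    rn r0 (by rw [one_mul]; exact r1) (by rw [zero_mul, add_zero]; exact r2) r3 hφrow isUnit_one hhu (one_mul _).symm isUnit_one
    rfix (A1.a1_model_closure_eq_top _) hK1 hK1' _ _ dg0 hφd (d * l) (Nat.mul_pos hver.1 hl) hver' U hcov u
    (fun _ => 1) (fun _ => one_pos) huJ huU

end Summit.ResolutionOfSingularities.ResolutionOfSingularities.Theorems.WildQuotientResolution.S1.GameFrame.GModel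

end
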